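import Summits.HodgeConjecture.HodgeConjecture.Theses.GaloisSieve
import Literature.AlgebraicGeometry.HodgeTheory.FermatHodgeConjectureAssembly
import Literature.AlgebraicGeometry.HodgeTheory.FermatHodgeConjectureProofs
import Summits.HodgeConjecture.HodgeConjecture.Theorems.DerivedTorelliFermatTargetGlue
import HarnessLib

/-!
# Route `GaloisSieve`, support `EigenlineAssembly` (stmt-HodgeConjecture-14565)

`HodgeEigenlines →` (Lefschetz off the middle degree for smooth hypersurfaces, inlined) `→`
(the eigenspace inputs, inlined) `→` every rational `(p,p)`-class on every smooth projective Fermat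
variety `Xⁿₘ` (`m ≥ 1`) is algebraic. Proof, as announced by the item: off the middle degree every
class is algebraic (`algebraicClasses_fermat_eq_top_of_two_mul_ne`, which also covers `p = 0` and
`p ≥ n` unconditionally); in the middle degree `n = 2p` transport along
`IsFermatVariety.isoFermatHypersurface` to the standard model `V₊(Σ xᵢᵐ) ⊂ ℙ²ᵖ⁺¹` and apply Ran's
assembly `mem_algebraicClasses_fermat_middle_of_eigenspaces`, feeding it the eigenspace inputs and
`HodgeEigenlines` through the dictionary "`c ∈ V(α)` ⟹ the explicit eigen-identity"
(`derivedTorelliFermat_diagonalMap_eq_of_mem_fermatEigenspace`, reused from the sibling route's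
`DerivedTorelliFermatTargetGlue`).
-/

set_option linter.dupNamespace false

noncomputable section

namespace Summit.HodgeConjecture.HodgeConjecture.Theorems

open CategoryTheory Literature.AlgebraicGeometry.Motives Literature.AlgebraicGeometry.HodgeTheory
  Literature.AlgebraicTopology.SingularHomology

/-- **Support item `EigenlineAssembly` of route `GaloisSieve`** (stmt-HodgeConjecture-14565): if
every Hodge eigenline of every Fermat `2p`-fold is algebraic, Lefschetz holds off the middle degree
for smooth hypersurfaces, and the eigenspace inputs hold, then every rational `(p,p)`-class on every
smooth projective Fermat variety `Xⁿₘ` (`m ≥ 1`) is algebraic. Off the middle: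
`algebraicClasses_fermat_eq_top_of_two_mul_ne`; in the middle: Ran's assembly on the standard model,
transported along `IsFermatVariety.isoFermatHypersurface`.
[cite: Ran1980, Thm. 4.9 and §1 Prop. 1.7] [cite: Shioda1979PJA, §2 Thm. 1 and §4] -/
theorem galoisSieve_eigenlineAssembly_proof :
    Summit.HodgeConjecture.HodgeConjecture.Theses.GaloisSieve.EigenlineAssembly := by
  intro hHE hL hE n m X hm hF hX p c hc hpp
  by_cases hmid : 2 * p = n
  swap
  · rw [algebraicClasses_fermat_eq_top_of_two_mul_ne hL hX hF hm hmid]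
    exact Submodule.mem_top
  -- the middle degree `n = 2p`
  subst hmid
  haveI : NeZero m := ⟨by omega⟩
  rcases Nat.eq_zero_or_pos p with rfl | hp
  · -- `n = 0`: codimension `0`
    rw [algebraicClasses_zero]; exact Submodule.mem_top
  obtain ⟨hE2, hE0, hE4⟩ := hE p m hp
  -- Step 1: the middle degree on the standard model
  have hstd : ∀ c : complexBetti (fermatHypersurface (2 * p) m) (2 * p), IsRationalClass c →
      IsOfHodgeType (2 * p) (fermatHypersurface (2 * p) m) (2 * p) p p c →
        c ∈ algebraicClasses (fermatHypersurface (2 * p) m) p := by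
    refine mem_algebraicClasses_fermat_middle_of_eigenspaces hp ?_ ?_ ?_ ?_
    · intro α hα0 hαi
      exact (Submodule.eq_bot_iff _).2 fun c hc ↦
        hE2 α hα0 hαi c (derivedTorelliFermat_diagonalMap_eq_of_mem_fermatEigenspace hc)
    · intro c hc
      exact hE0 c (derivedTorelliFermat_diagonalMap_eq_of_mem_fermatEigenspace hc)
    · rintro A β hβ ⟨x, hx, hx0, hxA⟩
      exact hE4 A β hβ ⟨x, derivedTorelliFermat_diagonalMap_eq_of_mem_fermatEigenspace hx, hx0, hxA⟩
    · intro α hα c hc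
      exact hHE p m α hp hα c (derivedTorelliFermat_diagonalMap_eq_of_mem_fermatEigenspace hc)
  -- Step 2: transport along `X ≅ V₊(Σ xᵢᵐ)`
  have hX' : IsSmoothProjective (2 * p) (fermatHypersurface (2 * p) m) :=
    isSmoothProjective_fermatHypersurface (by omega) NeZero.one_le
  let e : X ≅ fermatHypersurface (2 * p) m := hF.isoFermatHypersurface
  set c' : complexBetti (fermatHypersurface (2 * p) m) (2 * p) :=
    singularCohomology.map ℂ ℂ (AlgPoints.mapContinuous (L := ℂ) e.inv) (2 * p) c with hc'
  have hc'rat : IsRationalClass c' := hc.map _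
  have hc'pp : IsOfHodgeType (2 * p) (fermatHypersurface (2 * p) m) (2 * p) p p c' :=
    hpp.map_of_iso e.symm
  have halg := mem_algebraicClasses_map_of_iso hX' hX e (hstd c' hc'rat hc'pp)
  rwa [hc', show complexBetti.map e.hom (2 * p)
      (singularCohomology.map ℂ ℂ (AlgPoints.mapContinuous (L := ℂ) e.inv) (2 * p) c) = c from
    map_hom_map_inv_apply e (2 * p) c] at halg

end Summit.HodgeConjecture.HodgeConjecture.Theorems

end
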